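import Mathlib
import HarnessLib
import HarnessLib.Audit
import Summits.AtomisticToContinuum.Statement

/-!
Route: EnergyThinCores

CLOSED (retired) 2026-08-16T23:41:08Z by planner-rbadge-AtomisticToContinuum-EnergyThin-a354789c-0 — reason: not-a-thesis: superseded-by-retype D-0032/p126922 — after the packing-guarded re-type the route's conjunct-relevant residue is ThinGuardBandLimit ⇒ Statement, a strict strengthening with no why-easier; the thin-core mechanism bears only on  — note: route-repair rbadge-a354789c (glue badge), RETIRED not-a-thesis / superseded-by-retype (D-0032, p126922). (1) The needs_repair stamp 23:32Z ("281:8 introN failed") is STALE: it is rev 2's `closes := by intro …` against the re-typed `∃ η₀` conjunct; rev 3 (23:14:50Z, closes via HydrodynamicLimit.of_u. The file is kept as the record of this route; refuted decls are indexed as negative knowledge (`ledger negatives`).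

# Route EnergyThinCores — dense cores are energy-thin, hence invisible — the packing guard falls
without dilute self-consistency

It suffices to show X = ThinEnergySets ∧ ThinGuardBandLimit. ThinEnergySets (PDE, rank 2): for every
packing level η > 0 and all
continuous profiles there is σ₀ such that for σ < σ₀ every ADMISSIBLE classical hard-sphere-Euler
solution (t = 0 fields = LLN limit of
the local Gibbs laws) carries mass + total energy ≤ η on its σ-DENSE SET {x : ρ_t(x)σ³ ≥ η}, at
every t < T — dense excursions may
happen (implosion), but they are ENERGY-THIN. ThinGuardBandLimit (microscopic, rank 4): the
Euler-limit conclusion for classical solutions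
whose σ-dense set at level η₀ carries mass + energy ≤ η₀ (∃ η₀ outermost) — the packing-guarded
limit (former stmt-3093 HydroLimitInBand,
since the re-type 2026-08-16 THE CONJUNCT ITSELF) with its L∞ guard "ρσ³ < η₀ everywhere" relaxed to
an L¹ mass-and-energy guard.
X proves the UNGUARDED Literature conjecture
`Literature.MathematicalPhysics.KineticTheory.HydrodynamicLimit` (the conjunct as typed until
2026-08-16) by quantifier bookkeeping (σ₀ := min), and the re-typed, packing-guarded conjunct
follows by `HydrodynamicLimit.of_unguarded`;
that is the installed `closes : ThinEnergySets → ThinGuardBandLimit → HydrodynamicLimit`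
(route-repair 2026-08-16 after p126922, native OK).
RECORDED CONSEQUENCE OF THE RE-TYPE (not acted on by the repair seat; see KILL CRITERIA): under the
conjunct's new guard ∀ t < T ∀ x,
ρ_t(x)σ³ < η₀ the σ-dense set {ρ_tσ³ ≥ η₀} is EMPTY, so ThinGuardBandLimit ALONE already decides the
conjunct — certified alternative
deciding theorem `closes (hB : ThinGuardBandLimit) : HydrodynamicLimit` (planner folder
glue_direct.lean; farm rc 0, closes OK, advisory
glue.unused-crux ThinEnergySets) — and ThinEnergySets with its supports AdiabaticHeating /
ThinMassSets and the surgery engine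
CappedReferenceGronwall are load-bearing ONLY for the unguarded strengthening. Logical position now:
unguarded conjecture ⇒
ThinGuardBandLimit ⇒ conjunct (= HydroLimitInBandDim 3, `hydroLimitInBandDim_three_iff_root`). No
card is realised; the line answers
card implosion-beats-the-shock (Consequence A) and route ImplosionDichotomy from the positive side —
both of which the re-type also
disarmed with respect to the conjunct.
Lean: `ThinEnergySets ∧ ThinGuardBandLimit`

## Assembly
Pure quantifier bookkeeping behind one bridge lemma, installed as the deciding theorem `closes (hE :
ThinEnergySets)
(hB : ThinGuardBandLimit) : _root_.HydrodynamicLimit` (glue.lean, route-repair 2026-08-16): `refine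
HydrodynamicLimit.of_unguarded ?_`
reduces the packing-guarded conjunct to the unguarded Literature conjecture; then, given profiles,
take η₀ and σ₁ from ThinGuardBandLimit
and σ₂ from ThinEnergySets at η := η₀; σ₀ := min σ₁ σ₂; for σ < σ₀, a classical solution, flows Φ
and the t = 0 LLN, ThinEnergySets
(applied to the same Φ and LLN) supplies the energy-thin guard on [0,T), and ThinGuardBandLimit
returns the LLN at every t < T. The
supports are not hypotheses of `closes`: AdiabaticHeating → ThinMassSets is the provable half of
ThinEnergySets (mass), recorded so that
only the ENERGY half is open. (Alternative, shorter deciding theorem from ThinGuardBandLimit alone —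
the conjunct's guard empties the
dense set, `Measure.restrict_empty` + `integral_zero_measure` — certified but deliberately NOT
installed: it would leave ThinEnergySets
outside the route's argument and the route a one-crux, guard-relaxed restatement of the conjunct;
that decision is the tenure planner's.)

Rationale: WHY THIS LINE. Thirty-nine routes consume DiluteSelfConsistency (stmt-3091: admissible solutions
keep ρσ³ < η everywhere), and route ImplosionDichotomy
bets it is FALSE (DenseExcursion: smooth self-similar implosion — MerleEtAl2022,
BuckmasterCaolaboraGomezserrano2025, CaolaboraEtAl2025,
ShaoEtAl2025, ChenShkollerVicol2026 — drives the gas to packing O(1) before T*), declining any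
positive repair and handing the operator the
weaker conjunct HydroLimitInBand. This line says the dichotomy is false as a dichotomy: the
Statement survives dense excursions because they
are THIN. Mechanism, in three imported pieces: (i) hard-sphere THERMODYNAMICS — the gas is athermal
(e = 3θ/2) and classical solutions are
isentropic for s = (3/2)log θ − log ρ − f_ex(ρσ³) with f_ex nondecreasing (so Z ≥ 1 even at
`deriv`-junk points), hence compression heats at
least adiabatically, θ ≥ cρ^{2/3} (AdiabaticHeating), and energy conservation prices dense MASS:
∫_{ρσ³≥η} ρ ≤ C(σ³/η)^{2/3} (ThinMassSets,
provable now); (ii) compressible-Euler SINGULARITY THEORY — every implosion in print has Euler speed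
r < r*(3,ℓ) = r₊(3,ℓ) ≈ 1.27 at the
monatomic triple point ℓ = 2/(γ−1) = 3 (MRRS II, arXiv:1912.11009 p. 4), while the blow-up profile ρ
~ |x|^{−ℓ(r−1)}, energy density
~ |x|^{−(ℓ+2)(r−1)} focuses a POSITIVE energy fraction into the σ-dense set only if (ℓ+2)(r−1) ≥ 3,
i.e. r ≥ 8/5: known cores are energy-thin
with room (energy above density Λ = η/σ³ is ≲ Λ^{−2.06}); (iii) Yau/OVY RELATIVE ENTROPY WITH
REFERENCE SURGERY — run the guarded engines
against the local Gibbs law of the Euler profile CAPPED at packing η₀ (smooth cut-off on the dense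
set): the reference then solves Euler
wherever the true law has mass except on the thin set, the extra entropy production is ≤ N·(mass of
the cut-off layer)/(core radius) per unit
time over a dense phase of duration → 0 (for the MRRS profiles Λ^{−2.73}·Λ^{1.24} → 0), and exact
conservation of mass, momentum and energy
squeezes the χ-tested content of the core (U_N(core) = total − U_N(bulk) → U(core) ≤ η₀). What no
listed route does: prove Spohn's UNGUARDED
conjecture — the conjunct as typed until 2026-08-16, now
`Literature.MathematicalPhysics.KineticTheory.HydrodynamicLimit`, which implies the
re-typed packing-guarded conjunct by `HydrodynamicLimit.of_unguarded` (p126922) — along imploding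
admissible data; every other positive route
lives inside the L∞ packing band, which since the re-type is the conjunct's own hypothesis (so those
routes no longer die with stmt-3091, and
this route's extra strength is no longer needed FOR THE CONJUNCT — see KILL CRITERIA).

RANKED CRUXES. #2 ThinEnergySets (crux) — for every η > 0 and all continuous positive profiles (a₀,
u₀, θ₀) there is σ₀ > 0 such that for 0 < σ < σ₀, every classical hs-Euler solution (ρ,u,θ) on [0,T)
and every family of flows under which the local Gibbs fields converge to (ρ,ρu,E)(0): for all t < T,
∫ over {x : η ≤ ρ_t(x)σ³} of (ρ_t + E_t) dx ≤ η (E = ρ(|u|²/2 + 3θ/2)); since the re-type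
load-bearing only for the UNGUARDED strengthening reached inside `closes`, not for the conjunct.
[difficulty: L] (why it might fail: an unclassified first singularity, an implosion of Euler speed r
≥ 8/5 (none in print: r < r*(3,3) ≈ 1.27), or slow energy focusing in a global solution could put
energy ≥ η into {ρσ³ ≥ η} for all small σ; ThinMass alone allows ALL energy in the dense set.)
[MerleEtAl2022, arXiv:1912.11009, BuckmasterCaolaboraGomezserrano2025, CaolaboraEtAl2025,
ShaoEtAl2025, ChenShkollerVicol2026, Sideris1985]
#4 ThinGuardBandLimit (crux) — there is η₀ > 0 such that for all continuous positive profiles there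
is σ₀ with: for 0 < σ < σ₀, every classical hs-Euler solution on [0,T) whose σ-dense set {ρ_tσ³ ≥
η₀} carries mass + energy ≤ η₀ at every t < T, and every family of flows, the local Gibbs LLN at t =
0 implies the LLN of the density / momentum / energy fields at every t < T (the packing-guarded
limit with its L∞ guard relaxed to the ENERGY-THIN L¹ guard; since the re-type 2026-08-16: implied
by the unguarded Literature conjecture, and IMPLIES THE CONJUNCT ON ITS OWN — the conjunct's guard ∀
t x, ρ_tσ³ < η₀ empties the dense set; certified glue_direct.lean). [difficulty: open-problem] (why
it might fail: inherits the many-body closure problem of HydroLimitInBand (no noise-free engine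
yet); and the surgery pays N·(layer mass)/(core radius) per unit time — O(N) if a dense set is
mass-thin but geometrically fat and long-lived.) [OllaVaradhanYau1993, Yau1991, KipnisLandim1999,
NachtergaeleYau2003, BrezinaFeireisl2018, Spohn1991]
#9 AdiabaticHeating (support) — the thermodynamic lever: for all profiles there are c > 0 and σ₀
such that for σ < σ₀ every admissible classical solution satisfies c·ρ_t(x)^{2/3} ≤ θ_t(x) for all t
< T and x (isentropy of the hard-sphere adiabat along particle paths; f_ex nondecreasing gives Z ≥ 1
and (3/2)log θ − log ρ ≥ its initial value − f_ex(ρ₀σ³)). [difficulty: M] [Spohn1991, Ruelle1969,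
Dafermos2005]
#9 ThinMassSets (support) — dense mass is expensive: for all profiles there are C and σ₀ such that
for σ < σ₀, every η > 0 and every admissible classical solution, ∫ over {ρ_tσ³ ≥ η} of ρ_t dx ≤
C·(σ³/η)^{2/3} for all t < T (AdiabaticHeating + conservation of ∫E = ∫ρ(|u|²/2 + 3θ/2)).
[difficulty: provable-now] [Spohn1991, Ruelle1969, Sideris1985]

TWO-LAYER PLAN. ThinGuardBandLimit ⇐ CappedReferenceGronwall → CoreInvisibility → ThinGuardBandLimit
(k = 2): CappedReferenceGronwall = Yau's relative
entropy against the local Gibbs law of the profile CAPPED at packing η₀ (smooth cut-off S(ρσ³/η₀),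
S(s) = s for s ≤ 1/2), with the
extra production ≤ C·N·(mass of {η₀/2 ≤ ρσ³ ≤ η₀})/(distance scale of the cut-off) per unit time,
giving o(N) total on the thin set;
CoreInvisibility = bulk LLN + exact conservation ⇒ full LLN (|∫_core χ dU_N − ∫_core χU| ≤
‖χ‖∞·(U_N(core) + U(core)) with
U_N(core) = total − U_N(bulk)). ThinEnergySets ⇐ ThinMassSets → NoEnergyFocusing → ThinEnergySets (k
= 2): NoEnergyFocusing = the pure
energy half (energy above density Λ vanishes as Λ → ∞ uniformly on [0,T) for admissible solutions),
to be split further by singularity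
type (bounded-density breakdown: vacuous; MRRS-type implosion: profile exponents) only when a prover
asks.

KILL CRITERIA. ¬ThinEnergySets (an admissible family focusing energy ≥ η into {ρσ³ ≥ η} for
arbitrarily small σ) closes the route `refuted:ThinEnergySets`;
the witness is evidence against the UNGUARDED conjecture (a χ-visible hot core at packing O(1)), no
longer against the re-typed conjunct, whose
guard excludes such solutions. ¬ThinGuardBandLimit kills the line but NO LONGER refutes the conjunct
(since the re-type the conjunct is the
weaker statement: ThinGuardBandLimit ⇒ conjunct, not conversely). RE-TYPE 2026-08-16 (p126922,
D-0032) HAS REALISED THE MOOTING CRITERION IN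
SUBSTANCE: the packing guard ∀ t < T ∀ x, ρ_t(x)σ³ < η₀ is now a HYPOTHESIS of the conjunct, so the
energy-thin guard is never active for the
conjunct — ThinGuardBandLimit alone decides it (alternative `closes (hB : ThinGuardBandLimit) :
HydrodynamicLimit`, planner folder
glue_direct.lean, farm rc 0 / closes OK) and the thin-core mechanism (ThinEnergySets,
AdiabaticHeating, ThinMassSets, CappedReferenceGronwall)
bears only on the unguarded Literature conjecture, whose over-strength D-0032 removed from the
summit on purpose. PLANNER RECOMMENDATION
(route-repair seat rrepair-…-c0f29fa4, 2026-08-16; decision left to the tenure planner / priority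
owner, not taken here): unless the programme
wants Spohn's unguarded form as an explicit STRENGTHENING target, retire this route as superseded by
the re-type — its conjunct-relevant
residue "ThinGuardBandLimit ⇒ conjunct" is a guard-relaxed restatement of the conjunct (= former
stmt-3093 HydroLimitInBand), i.e. a one-crux
route under the D-0019 floor with no why-easier; in any case do NOT staff ThinEnergySets (rank 2, a
3-D compressible-Euler blow-up
classification question) on the conjunct's account. The one conjunct-relevant descendant of the idea
is MICROSCOPIC, not this route: dense
microscopic clusters (empirical packing ≥ η₀ on mesoscopic balls while the Euler profile stays
dilute) carrying vanishing mass + energy under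
the true law — the density-space twin of SpeedCapSurgery's velocity surgery — which would be a new
thesis for the plan-novel seat.
DiluteSelfConsistency (stmt-3091) proved elsewhere ⇒ equally moot (as before). DenseExcursion proved
⇒ relevant to the strengthening only.

NOT DECOMPOSED YET. The surgery lemma CappedReferenceGronwall and its capped-profile object (a
definition request once a prover takes ThinGuardBandLimit); the
conservation squeeze CoreInvisibility (measure theory, cheap); the split of ThinEnergySets by
singularity type; the statics regularity the
supports use off the dilute range (hsExcessFreeEnergy nondecreasing below close packing — set
inclusion; continuity/convexity of the limit
free energy — Ruelle1969 §3.4) and the typed-EOS junk points of `deriv` at moderate packing, which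
ImplosionDichotomy's items face equally.

CHEAPEST FALSIFIER. Arithmetic on the printed exponents (done here): with ℓ = 2/(γ−1) = 3 and every
admissible Euler speed r < r*(3,3) = (3+3)/(3+√3) ≈ 1.268
(arXiv:1912.11009 p. 4), the blow-up profile has ρ ~ |x|^{−ℓ(r−1)} = |x|^{−0.80} and energy density
~ |x|^{−(ℓ+2)(r−1)} = |x|^{−1.34}, both
integrable, so the energy above density Λ is ≲ Λ^{−(3−1.34)/0.80} ≈ Λ^{−2.06}: known implosions
PASS. The refuter's next cheapest check: a
literature lookup for ANY finite-energy 3-D compressible-Euler blow-up from smooth data with energy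
concentration (speed r ≥ 8/5, or a
non-self-similar scenario) — one such admissible family kills ThinEnergySets.

NUMBERS. ℓ = 2/(γ−1) = 3 (monatomic, the σ → 0 limit of the hs equation of state); r*(3,ℓ) =
(3+ℓ)/(ℓ+√3), r₊(3,ℓ) = 1 + 2/(1+√ℓ)², equal ≈ 1.268 at
ℓ = 3 (MRRS II p. 4: "ℓ = 3 … is exceptional and signals a phase transition"); ‖ρ‖∞ ≍
(T*−t)^{−ℓ(r−1)/r}; core mass ~ (T*−t)^{(3−ℓ(r−1))/r}
(thin iff r < 2), core energy ~ (T*−t)^{(3−(ℓ+2)(r−1))/r} (thin iff r < 8/5); ThinMassSets constant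
C = (4E₀/3θ_min)·ρ_{0,max}^{2/3};
stmt-3091 wanted by 39 routes (ImplosionDichotomy rationale, 2026-08-16). Items at open: 5 (2
cruxes, 2 supports, 1 assembly). Route-repair 2026-08-16 (statement re-type p126922, old sha
76bd4b7872eb → new 98f46613f7a5): `closes` re-elaborated through `HydrodynamicLimit.of_unguarded`,
items unchanged (6: 2 cruxes, 3 supports incl. the informal CappedReferenceGronwall, 1 assembly).

DEFINITION REQUESTS. None at open (all statements over HardSphereEuler.lean vocabulary). Foreseen
with the layer-2 split of ThinGuardBandLimit: `cappedProfile`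
(smooth packing cap of a classical solution) under
Summits/AtomisticToContinuum/HydrodynamicLimit/Theorems.

Novelty: Searches (2026-08-16): `lit frontier AtomisticToContinuum --since 2022` (30 rows: DHM survey
arXiv:2602.04407, CLO heat equation
arXiv:2310.13338, BEC/Fermi items — nothing on dense excursions or thin sets); `lit galaxy search
"hydrodynamic limit of hard spheres" --star all`
(0); `lit galaxy search "Enskog equation" --star pdf` (30, dense-gas kinetic theory and granular
media only); `lit search --source openalex|arxiv
"hard spheres positive density hydrodynamic limit Euler"` (rate-limited / 0); `lit read
arXiv:1912.11009 pp. 1–10` (MRRS: r*, r₊, ℓ = 3 triple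
point); grep of all 137 route files and 145 idea cards of the sub for thin / core / capped / surgery
/ "vanishing mass" (hits: velocity-space
surgery KineticEnergySurgery–SpeedCapSurgery, HeatBath cells, corners pricing — none on macroscopic
dense sets); full read of route
ImplosionDichotomy and card implosion-beats-the-shock; `ledger negatives --problem
AtomisticToContinuum` (15).
Nearest prior art found: route-AtomisticToContinuum-ImplosionDichotomy (closes :
DiluteSelfConsistency → HydroLimitInBand → HydrodynamicLimit;
bets DenseExcursion; "no repair of the positive half is attempted", operator handed
HydroLimitInBand) and card implosion-beats-the-shock
(arXiv:1912.11009, arXiv:2208.09445, arXiv:2310.05325, arXiv:2501.15701; Consequence A "no route can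
prove the conjunct as stated");
route SpeedCapSurgery (surgery in VELOCITY space justified by extreme-value thinness).
Delta: the packing guard is removed without dilute  [refs: 2602.04407, 2310.13338, 1912.11009, 2208.09445, 2310.05325, 2501.15701]

Barriers (technique_class: isentropic-energy-bound, reference-surgery, implosion): - technique_class: isentropic-energy-bound, reference-surgery, implosion
- Literature.Barriers.AtomisticToContinuum.ShockFormationBarrier: respected, not evaded — everything
is pre-T* for whatever the first singularity is; the barrier's printed content (smooth reference
needed) is exactly why the reference is CAPPED on the thin set rather than followed into the core.
- Literature.Barriers.AtomisticToContinuum.DiluteRegimeBarrier: not engaged — no Boltzmann–Grad or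
kinetic expansion; statics are used only at packing ≤ η₀ (the bulk and the capped reference), the
core is never expanded.
- Literature.Barriers.AtomisticToContinuum.NoDensityExpansionBarrier: not engaged — Euler order
only, no transport coefficients, no density series beyond the convergent low-packing virial EOS in
the bulk.
- Literature.Barriers.AtomisticToContinuum.BoltzmannHypothesisBarrier: it does bite, on
ThinGuardBandLimit, exactly as on HydroLimitInBand; the bet of this route is the GUARD, not the
ergodic input — whichever engine closes 3093 closes the capped version at o(N) extra cost.
- Literature.Barriers.AtomisticToContinuum.MacroErgodicityBarrier: same concession as the previous
line.
- Literature.Barriers.AtomisticToContinuum.HighMomentumCutoffBarrier: bites on ThinGuardBandLimit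
(cubic tails under the true law); not addressed here; note the hot core is NOT a tail problem for
the reference (capped θ) but is one for the true law — absorbed in the thin-set cost only if the
core ENERGY is thin, which is w

History (route lifecycle, newest last):
- 2026-08-16T16:44:07Z · rev 1: dropped stmt-AtomisticToContinuum-15775 — duplicate of stmt-AtomisticToContinuum-15726 (same informal crux CappedReferenceGronwall filed twice by a CLI retry); keep 15726 (planner-plan-novel-AtomisticToContinuum-Hydrody-41806d41-v2-)
- 2026-08-16T23:41:08Z · CLOSED retired — not-a-thesis: superseded-by-retype D-0032/p126922 — after the packing-guarded re-type the route's conjunct-relevant residue is ThinGuardBandLimit ⇒ Statement, a strict strengthening with no why-easier (planner-rbadge-AtomisticToContinuum-EnergyThin-a354789c-0)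

sub-problem: HydrodynamicLimit · status: closed(retired) · opened planner-plan-novel-AtomisticToContinuum-Hydrody-41806d41-v2-g2-0 2026-08-16T16:38:40Z · rev 3 · ledger route-AtomisticToContinuum-EnergyThinCores
GENERATED by the gate from the ledger (D-0016/17). Provers cite these decls: `theorem foo : Summit.AtomisticToContinuum.HydrodynamicLimit.Theses.EnergyThinCores.<Decl> := …` in Summits/AtomisticToContinuum/HydrodynamicLimit/Theorems/<Name>.lean.
-/

namespace Summit.AtomisticToContinuum.HydrodynamicLimit.Theses.EnergyThinCores

open scoped BigOperators Topology Manifold Classical MeasureTheory ProbabilityTheory Matrix InnerProductSpace ComplexConjugate ContinuousMap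
open Filter Set Function TopologicalSpace MeasureTheory

attribute [summit_statement] _root_.HydrodynamicLimit

/-- item stmt-AtomisticToContinuum-15704 · crux · rank 2 · closed · moot by None · by planner
why it might fail: an unclassified first singularity, an implosion of Euler speed r ≥ 8/5 (none in print: r < r*(3,3) ≈ 1.27), or slow energy focusing in a global solution could put energy ≥ η into {ρσ³ ≥ η} for all small σ; ThinMass alone allows ALL energy in the dense set.
sources: MerleEtAl2022, arXiv:1912.11009, BuckmasterCaolaboraGomezserrano2025, CaolaboraEtAl2025, ShaoEtAl2025, ChenShkollerVicol2026
[crux] for every η > 0 and all continuous positive profiles (a₀, u₀, θ₀) there is σ₀ > 0 such that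
for 0 < σ < σ₀, every classical hs-Euler solution (ρ,u,θ) on [0,T) and every family of flows under
which the local Gibbs fields converge to (ρ,ρu,E)(0): for all t < T, ∫ over {x : η ≤ ρ_t(x)σ³} of
(ρ_t + E_t) dx ≤ η (E = ρ(|u|²/2 + 3θ/2)). [difficulty: L] -/
@[route_item "route-AtomisticToContinuum-EnergyThinCores"]
def ThinEnergySets : Prop :=
  ∀ η : ℝ, 0 < η → ∀ (a₀ θ₀ : Literature.MathematicalPhysics.KineticTheory.T3 → ℝ) (u₀ : Literature.MathematicalPhysics.KineticTheory.T3 → Literature.MathematicalPhysics.KineticTheory.V3), Continuous a₀ → Continuous θ₀ → Continuous u₀ → (∀ x, 0 < a₀ x) → (∀ x, 0 < θ₀ x) → ∃ σ₀ : ℝ, 0 < σ₀ ∧ ∀ σ : ℝ, 0 < σ → σ < σ₀ → ∀ (T : ℝ) (ρ θ : ℝ → Literature.MathematicalPhysics.KineticTheory.T3 → ℝ) (u : ℝ → Literature.MathematicalPhysics.KineticTheory.T3 → Literature.MathematicalPhysics.KineticTheory.V3), Literature.MathematicalPhysics.KineticTheory.IsHardSphereEulerSolution σ T ρ u θ → ∀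 Φ : (N : ℕ) → Literature.Analysis.FluidPDE.HardSphereFlow (Literature.Analysis.FluidPDE.Torus.geometry (Fin 3)) (Literature.MathematicalPhysics.KineticTheory.hsDiameter σ N) (N + 1), Literature.MathematicalPhysics.KineticTheory.TendstoHydroFieldsAt (fun N => Literature.MathematicalPhysics.KineticTheory.localGibbsLaw σ a₀ u₀ θ₀ N (Φ N)) Φ ρ u θ 0 → ∀ t ∈ Set.Ico 0 T, ∫ x in {x | η ≤ ρ t x * σ ^ 3}, (ρ t x + Literature.MathematicalPhysics.KineticTheory.totalEnergyDensity (ρ t x) (u t x) (θ t x)) ≤ η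

/-- item stmt-AtomisticToContinuum-15705 · crux · rank 4 · closed · moot by None · by planner
why it might fail: inherits the many-body closure problem of HydroLimitInBand (no noise-free engine yet); and the surgery pays N·(layer mass)/(core radius) per unit time — O(N) if a dense set is mass-thin but geometrically fat and long-lived.
sources: OllaVaradhanYau1993, Yau1991, KipnisLandim1999, NachtergaeleYau2003, BrezinaFeireisl2018, Spohn1991
[crux] there is η₀ > 0 such that for all continuous positive profiles there is σ₀ with: for 0 < σ <
σ₀, every classical hs-Euler solution on [0,T) whose σ-dense set {ρ_tσ³ ≥ η₀} carries mass + energy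
≤ η₀ at every t < T, and every family of flows, the local Gibbs LLN at t = 0 implies the LLN of the
density / momentum / energy fields at every t < T (the conjunct under the ENERGY-THIN guard; implied
by the Statement, implies HydroLimitInBand). [difficulty: open-problem] -/
@[route_item "route-AtomisticToContinuum-EnergyThinCores"]
def ThinGuardBandLimit : Prop :=
  ∃ η₀ : ℝ, 0 < η₀ ∧ ∀ (a₀ θ₀ : Literature.MathematicalPhysics.KineticTheory.T3 → ℝ) (u₀ : Literature.MathematicalPhysics.KineticTheory.T3 → Literature.MathematicalPhysics.KineticTheory.V3), Continuous a₀ → Continuous θ₀ → Continuous u₀ → (∀ x, 0 < a₀ x) → (∀ x, 0 < θ₀ x) → ∃ σ₀ : ℝ, 0 < σ₀ ∧ ∀ σ : ℝ, 0 < σ → σ < σ₀ → ∀ (T : ℝ) (ρ θ : ℝ → Literature.MathematicalPhysics.KineticTheory.T3 → ℝ) (u : ℝ → Literature.MathematicalPhysics.KineticTheory.T3 → Literature.MathematicalPhysics.KineticTheory.V3), Literature.MathematicalPhysics.KineticTheory.IsHardSphereEulerSolution σ T ρ u θ → (∀ t ∈ Set.Ico 0 T, ∫ x in {x | η₀ ≤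 ρ t x * σ ^ 3}, (ρ t x + Literature.MathematicalPhysics.KineticTheory.totalEnergyDensity (ρ t x) (u t x) (θ t x)) ≤ η₀) → ∀ Φ : (N : ℕ) → Literature.Analysis.FluidPDE.HardSphereFlow (Literature.Analysis.FluidPDE.Torus.geometry (Fin 3)) (Literature.MathematicalPhysics.KineticTheory.hsDiameter σ N) (N + 1), Literature.MathematicalPhysics.KineticTheory.TendstoHydroFieldsAt (fun N => Literature.MathematicalPhysics.KineticTheory.localGibbsLaw σ a₀ u₀ θ₀ N (Φ N)) Φ ρ u θ 0 → ∀ t ∈ Set.Ico 0 T, Literature.MathematicalPhysics.KineticTheory.TendstoHydroFieldsAt (fun N => Literature.MathematicalPhysics.KineticTheory.localGibbsLaw σ a₀ u₀ θ₀ N (Φ N)) Φ ρ u θ t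

-- item stmt-AtomisticToContinuum-15726 · support · rank 3 · closed · moot by None · by planner — informal only, no Lean statement yet:
--   [crux] REFERENCE SURGERY (layer-2 engine of ThinGuardBandLimit; informal until the capped-profile
--   object is defined): setting of ThinGuardBandLimit (classical hs-Euler solution (ρ,u,θ) on [0,T) at σ
--   < σ₀ whose σ-dense set {ρσ³ ≥ η₀} carries mass + energy ≤ η₀; local Gibbs data tied at t = 0). Let
--   (ρ̃,ũ,θ̃) be the CAPPED profile: ρ̃ = (η₀/σ³)·S(ρσ³/η₀) with S smooth nondecreasing, S(s) = s for s
--   ≤ 1/2, S ≤ 1, and θ, u capped likewise at levels fixed by the profiles; ψ̃_t := localGibbsLaw σ ã_t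
--   ũ_t θ̃_t (activity ã_t realising ρ̃_t). CLAIM: klDiv(lawAt Φ_N (localGibbsLaw σ a₀ u₀ θ₀) t ‖
--   ψ̃_t)/(N

/-- item stmt-AtomisticToContinuum-15706 · support · rank 9 · closed · moot by None · by planner
sources: Spohn1991, Ruelle1969, Dafermos2005
[support] the thermodynamic lever: for all profiles there are c > 0 and σ₀ such that for σ < σ₀
every admissible classical solution satisfies c·ρ_t(x)^{2/3} ≤ θ_t(x) for all t < T and x (isentropy
of the hard-sphere adiabat along particle paths; f_ex nondecreasing gives Z ≥ 1 and (3/2)log θ − log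
ρ ≥ its initial value − f_ex(ρ₀σ³)). [difficulty: M] -/
@[route_item "route-AtomisticToContinuum-EnergyThinCores"]
def AdiabaticHeating : Prop :=
  ∀ (a₀ θ₀ : Literature.MathematicalPhysics.KineticTheory.T3 → ℝ) (u₀ : Literature.MathematicalPhysics.KineticTheory.T3 → Literature.MathematicalPhysics.KineticTheory.V3), Continuous a₀ → Continuous θ₀ → Continuous u₀ → (∀ x, 0 < a₀ x) → (∀ x, 0 < θ₀ x) → ∃ c : ℝ, 0 < c ∧ ∃ σ₀ : ℝ, 0 < σ₀ ∧ ∀ σ : ℝ, 0 < σ → σ < σ₀ → ∀ (T : ℝ) (ρ θ : ℝ → Literature.MathematicalPhysics.KineticTheory.T3 → ℝ) (u : ℝ → Literature.MathematicalPhysics.KineticTheory.T3 → Literature.MathematicalPhysics.KineticTheory.V3), Literature.MathematicalPhysics.KineticTheory.IsHardSphereEulerSolution σ T ρ u θ → ∀ Φ : (N : ℕ) → Literature.Analysis.FluidPDE.HardSphereFlow (Literature.Analysis.FluidPDE.Torus.geometry (Fin 3)) (Literature.MathematicalPhysics.KineticTheory.hsDiameter σ N) (N + 1), Literature.MathematicalPhysics.KineticTheory.TendstoHydroFieldsAt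 (fun N => Literature.MathematicalPhysics.KineticTheory.localGibbsLaw σ a₀ u₀ θ₀ N (Φ N)) Φ ρ u θ 0 → ∀ t ∈ Set.Ico 0 T, ∀ x, c * (ρ t x) ^ (2 / 3 : ℝ) ≤ θ t x

/-- item stmt-AtomisticToContinuum-15707 · support · rank 9 · closed · moot by None · by planner
sources: Spohn1991, Ruelle1969, Sideris1985
[support] dense mass is expensive: for all profiles there are C and σ₀ such that for σ < σ₀, every η
> 0 and every admissible classical solution, ∫ over {ρ_tσ³ ≥ η} of ρ_t dx ≤ C·(σ³/η)^{2/3} for all t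
< T (AdiabaticHeating + conservation of ∫E = ∫ρ(|u|²/2 + 3θ/2)). [difficulty: provable-now] -/
@[route_item "route-AtomisticToContinuum-EnergyThinCores"]
def ThinMassSets : Prop :=
  ∀ (a₀ θ₀ : Literature.MathematicalPhysics.KineticTheory.T3 → ℝ) (u₀ : Literature.MathematicalPhysics.KineticTheory.T3 → Literature.MathematicalPhysics.KineticTheory.V3), Continuous a₀ → Continuous θ₀ → Continuous u₀ → (∀ x, 0 < a₀ x) → (∀ x, 0 < θ₀ x) → ∃ C : ℝ, ∃ σ₀ : ℝ, 0 < σ₀ ∧ ∀ σ : ℝ, 0 < σ → σ < σ₀ → ∀ η : ℝ, 0 < η → ∀ (T : ℝ) (ρ θ : ℝ → Literature.MathematicalPhysics.KineticTheory.T3 → ℝ) (u : ℝ → Literature.MathematicalPhysics.KineticTheory.T3 → Literature.MathematicalPhysics.KineticTheory.V3), Literature.MathematicalPhysics.KineticTheory.IsHardSphereEulerSolution σ T ρ u θ → ∀ Φ : (N : ℕ) → Literature.Analysis.FluidPDE.HardSphereFlow (Literature.Analysis.FluidPDE.Torus.geometry (Fin 3)) (Literature.MathematicalPhysics.KineticTheory.hsDiameter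 σ N) (N + 1), Literature.MathematicalPhysics.KineticTheory.TendstoHydroFieldsAt (fun N => Literature.MathematicalPhysics.KineticTheory.localGibbsLaw σ a₀ u₀ θ₀ N (Φ N)) Φ ρ u θ 0 → ∀ t ∈ Set.Ico 0 T, ∫ x in {x | η ≤ ρ t x * σ ^ 3}, ρ t x ≤ C * (σ ^ 3 / η) ^ (2 / 3 : ℝ)

/-- item stmt-AtomisticToContinuum-15708 · assembly · rank 1 · closed · moot by None · by planner
sources: OllaVaradhanYau1993, Spohn1991
[assembly] ThinEnergySets → ThinGuardBandLimit → HydrodynamicLimit. -/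
@[route_item "route-AtomisticToContinuum-EnergyThinCores"]
def Assembly : Prop :=
  ThinEnergySets → ThinGuardBandLimit → _root_.HydrodynamicLimit

end Summit.AtomisticToContinuum.HydrodynamicLimit.Theses.EnergyThinCores
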